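import Summits.RiemannHypothesis.RiemannHypothesis.Theorems.WeilGroundStateArchimedeanWindowSimpleEvenGapDefs
import HarnessLib

/-!
# `ArchimedeanWindowSimpleEven` — soundness of the gap certificate, I: tables and block identities

Unpacking of the Boolean checks (`allLin`/`allB`, `checkG`, the moment table), the entries of the
materialized gap blocks, positivity of a checked block (`R + UᵀU`, `R` diagonally dominant), the
Bessel expression in `y`-coordinates and the gap block identity
`P-term + κ'·Bessel + [p = 0] λ (c cᵀ)-term = y* S_p y` (from `WeilCert.block_identity`).

Route `RiemannHypothesis/WeilGroundState`, item `ArchimedeanWindowSimpleEven` (stmt-RiemannHypothesis-1529).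
See `WeilGroundStateArchimedeanWindowSimpleEvenGapDefs.lean` for the certificate format, the data and the
overall plan (LOWER bounds by the gap certificate `weilGapCert`, UPPER bound `ε((log 2)/2) ≤ 3/200` by the
trial function `trialFun`).
-/

namespace Summit.RiemannHypothesis.RiemannHypothesis.Theorems.WeilGroundState

open Literature.NumberTheory.LFunctions

/-! ## Soundness of the gap certificate -/

namespace WeilGapCert

open Complex Finset MeasureTheory Set Filter
open scoped Real ComplexConjugate BigOperators

variable {c : WeilGapCert}

/-! ### Unpacking the Boolean checks -/

/-- `allLin lo len P = true → P (lo + k)` for `k < len`. [folklore] -/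
theorem allLin_spec {lo len : ℕ} {P : ℕ → Bool} (h : allLin lo len P = true) {k : ℕ} (hk : k < len) :
    P (lo + k) = true := by
  induction len with
  | zero => exact absurd hk (Nat.not_lt_zero _)
  | succ n ih =>
    have h' : (allLin lo n P && P (lo + n)) = true := h
    rw [Bool.and_eq_true] at h'
    rcases Nat.lt_succ_iff_lt_or_eq.1 hk with hk' | rfl
    · exact ih h'.1 hk'
    · exact h'.2

/-- `allB fuel lo len P = true → P k` for `lo ≤ k < lo + len`. [folklore] -/
theorem allB_spec {fuel lo len : ℕ} {P : ℕ → Bool} (h : allB fuel lo len P = true) {k : ℕ}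
    (h1 : lo ≤ k) (h2 : k < lo + len) : P k = true := by
  induction fuel generalizing lo len with
  | zero =>
    have h' : allLin lo len P = true := h
    obtain ⟨d, rfl⟩ := Nat.exists_eq_add_of_le h1
    exact allLin_spec h' (by omega)
  | succ f ih =>
    have h' : (if len ≤ 1 then allLin lo len P
        else allB f lo (len / 2) P && allB f (lo + len / 2) (len - len / 2) P) = true := h
    split_ifs at h' with hlen
    · obtain ⟨d, rfl⟩ := Nat.exists_eq_add_of_le h1
      exact allLin_spec h' (by omega)
    · rw [Bool.and_eq_true] at h'
      rcases lt_or_ge k (lo + len / 2) with hk | hk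
      · exact ih h'.1 h1 hk
      · exact ih h'.2 hk (by omega)

/-- Unpacking `checkG`. [folklore] -/
theorem checkG_spec (h : c.checkG = true) :
    checkCells c.base.prec c.base.wL c.base.T c.base.mwT c.base.cells = true ∧
      c.base.checkScalars c.nu = true ∧ 0 ≤ c.kappaG ∧ c.checkNuA = true ∧ c.checkNuB = true ∧
      c.checkBlockG 0 = true ∧ c.checkBlockG 1 = true := by
  unfold checkG at h
  simp only [Bool.and_eq_true, decide_eq_true_eq] at h
  exact ⟨h.1.1.1.1.1.1, h.1.1.1.1.1.2, h.1.1.1.1.2, h.1.1.1.2, h.1.1.2, h.1.2, h.2⟩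

/-- The table bounds `ν_q ≤ nu[q] ≤ ν_q + 2^{-pnu}` for `q ≤ 2N`. [folklore] -/
theorem nu_bounds (hA : c.checkNuA = true) (hB : c.checkNuB = true) {q : ℕ} (hq : q ≤ 2 * c.base.N) :
    c.base.nuQ q ≤ getV c.nu q ∧ getV c.nu q ≤ c.base.nuQ q + 1 / 2 ^ c.pnu := by
  have hP : c.nuP q = true := by
    rcases lt_or_ge q (c.base.N + 1) with h | h
    · exact allB_spec hA (Nat.zero_le _) (by simpa using h)
    · exact allB_spec hB h (by omega)
  unfold nuP at hP
  simpa only [Bool.and_eq_true, decide_eq_true_eq] using hP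

/-! ### Table lemmas -/

/-- Entries of the materialized gap block `S_p`. [folklore] -/
theorem getM_sgBlk (p : ℕ) {i j : ℕ} (hi : i < c.base.nb) (hj : j < c.base.nb) :
    getM (c.sgBlk p) i j =
      (∑ k ∈ range c.base.nb, getM (c.base.Db p) k i *
          ∑ l ∈ range c.base.nb, c.base.prQ c.nu (2 * k + p) (2 * l + p) * getM (c.base.Db p) l j) +
        c.kappaG * ((if i = j then 2 * c.base.bQ p i else 0) -
          c.base.bQ p i * c.base.bQ p j * getM (c.base.hpBlk p) i j) +
        (if p = 0 then c.lam * getV c.cvec i * getV c.cvec j else 0) := by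
  unfold sgBlk
  dsimp only
  rw [getM_tabM _ hi hj, sumR_eq_sum]
  congr 2
  exact Finset.sum_congr rfl fun k hk ↦ by rw [c.base.getM_pdBlk c.nu p (Finset.mem_range.1 hk) hj]

/-- Entries of the materialized `R = S_p − UᵀU`. [folklore] -/
theorem getM_rgBlk (p : ℕ) {i j : ℕ} (hi : i < c.base.nb) (hj : j < c.base.nb) :
    getM (c.rgBlk p) i j =
      getM (c.sgBlk p) i j -
        ∑ k ∈ range c.base.nb, getM (c.base.Ub p) k i * getM (c.base.Ub p) k j := by
  unfold rgBlk
  dsimp only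
  rw [getM_tabM _ hi hj, sumR_eq_sum]

/-- **Gap block positivity** from the dominance check. [folklore] -/
theorem sgFun_quad_nonneg {p : ℕ} (h : c.checkBlockG p = true) (x : ℕ → ℝ) :
    0 ≤ ∑ i ∈ range c.base.nb, ∑ j ∈ range c.base.nb, c.sgFun p i j * (x i * x j) := by
  unfold checkBlockG at h
  rw [Bool.and_eq_true] at h
  have hdom := h.2
  set R : ℕ → ℕ → ℝ := fun i j ↦ (getM (c.rgBlk p) i j : ℝ) with hR
  set U : ℕ → ℕ → ℝ := fun i j ↦ (getM (c.base.Ub p) i j : ℝ) with hU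
  have hsplit : ∀ i ∈ range c.base.nb, ∀ j ∈ range c.base.nb,
      c.sgFun p i j = R i j + ∑ k ∈ range c.base.nb, U k i * U k j := by
    intro i hi j hj
    rw [hR, hU, sgFun]
    simp only
    rw [c.getM_rgBlk p (Finset.mem_range.1 hi) (Finset.mem_range.1 hj)]
    push_cast
    ring
  have h1 : ∑ i ∈ range c.base.nb, ∑ j ∈ range c.base.nb, c.sgFun p i j * (x i * x j) =
      ∑ i ∈ range c.base.nb, ∑ j ∈ range c.base.nb, R i j * (x i * x j) +
        ∑ i ∈ range c.base.nb, ∑ j ∈ range c.base.nb,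
          (∑ k ∈ range c.base.nb, U k i * U k j) * (x i * x j) := by
    rw [← Finset.sum_add_distrib]
    refine Finset.sum_congr rfl fun i hi ↦ ?_
    rw [← Finset.sum_add_distrib]
    refine Finset.sum_congr rfl fun j hj ↦ ?_
    rw [hsplit i hi j hj]
    ring
  rw [h1]
  refine add_nonneg (WeilAlg.quad_nonneg_of_dominant c.base.nb R (fun i hi ↦ ?_) x)
    (WeilAlg.quad_gram_nonneg c.base.nb U x)
  have hd := WeilCert.of_checkDom hdom (Finset.mem_range.1 hi)
  rw [hR]
  simp only
  have : ∑ j ∈ range c.base.nb, (if j = i then (0 : ℝ) else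
      (|((getM (c.rgBlk p) i j : ℚ) : ℝ)| + |((getM (c.rgBlk p) j i : ℚ) : ℝ)|) / 2) =
      ((∑ j ∈ range c.base.nb, (if j = i then (0 : ℚ) else
        (|getM (c.rgBlk p) i j| + |getM (c.rgBlk p) j i|) / 2) : ℚ) : ℝ) := by
    push_cast
    refine Finset.sum_congr rfl fun j _ ↦ ?_
    split_ifs <;> simp
  rw [this]
  exact_mod_cast hd

/-- The Bessel block `B_p(j,j') = 2 b_j δ_{jj'} − b_j b_{j'} H'_{jj'}` as a real matrix. [folklore] -/
theorem sgFun_eq (p : ℕ) {j j' : ℕ} (hj : j < c.base.nb) (hj' : j' < c.base.nb) :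
    c.sgFun p j j' =
      WeilCert.spFun c.base c.nu p j j' -
        ((c.theta + c.nuErrQ : ℚ) : ℝ) *
          (((if j = j' then 2 * c.base.bQ p j else 0) -
            c.base.bQ p j * c.base.bQ p j' * getM (c.base.hpBlk p) j j' : ℚ) : ℝ) +
        (if p = 0 then ((c.lam * getV c.cvec j * getV c.cvec j' : ℚ) : ℝ) else 0) := by
  rw [sgFun, WeilCert.spFun, c.getM_sgBlk p hj hj', c.base.getM_spBlk c.nu p hj hj', kappaG]
  push_cast
  split_ifs <;> push_cast <;> ring

end WeilGapCert


namespace WeilGapCert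

open Complex Finset MeasureTheory Set Filter
open scoped Real ComplexConjugate BigOperators

variable {c : WeilGapCert}

/-! ### The Bessel expression and the gap block identity -/

/-- **The Bessel expression in `y`-coordinates.** For the base certificate's test polynomial `u = uVec M`
and `y = yVec M p`:
`2 Σ_i conj(u_{2i+p}) M_{2i+p} − Σ_{i,i'} conj(u_{2i+p}) u_{2i'+p} H_p(i,i') = Σ_{j,j'} B_p(j,j') conj(y_j) y_{j'}`
with `B_p(j,j') = 2 b_j δ_{jj'} − b_j b_{j'} H'_{jj'}`. (Extracted from the proof of
`WeilCert.block_identity`.) [folklore] -/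
theorem bessel_identity {p : ℕ} (hp : p < 2) (M : ℕ → ℂ) :
    2 * ∑ i ∈ range c.base.nb, conj (c.base.uVec M (2 * i + p)) * M (2 * i + p) -
        ∑ i ∈ range c.base.nb, ∑ i' ∈ range c.base.nb,
          conj (c.base.uVec M (2 * i + p)) * c.base.uVec M (2 * i' + p) * (c.base.hBlkQ p i i' : ℂ) =
      ∑ j ∈ range c.base.nb, ∑ j' ∈ range c.base.nb,
        ((((if j = j' then 2 * c.base.bQ p j else 0) -
            c.base.bQ p j * c.base.bQ p j' * getM (c.base.hpBlk p) j j' : ℚ) : ℝ) : ℂ) *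
          (conj (c.base.yVec M p j) * c.base.yVec M p j') := by
  set nb := c.base.nb with hnb
  set y : ℕ → ℂ := c.base.yVec M p with hy
  set C : ℕ → ℕ → ℝ := fun i j ↦ (getM (c.base.Cb p) i j : ℝ) with hC
  set b : ℕ → ℝ := fun j ↦ (c.base.bQ p j : ℝ) with hb
  have hu : ∀ i, c.base.uVec M (2 * i + p) = ∑ j ∈ range nb, ((C j i * b j : ℝ) : ℂ) * y j := by
    intro i
    rw [WeilCert.uVec_block M p i hp, hC, hb, hy, ← hnb]
    refine Finset.sum_congr rfl fun j _ ↦ ?_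
    push_cast
    rfl
  have hu1 : 2 * ∑ i ∈ range nb, conj (c.base.uVec M (2 * i + p)) * M (2 * i + p) =
      ∑ j ∈ range nb, ∑ j' ∈ range nb,
        ((if j = j' then 2 * b j else 0 : ℝ) : ℂ) * (conj (y j) * y j') := by
    have e1 : ∀ i ∈ range nb, conj (c.base.uVec M (2 * i + p)) * M (2 * i + p) =
        ∑ j ∈ range nb, (b j : ℂ) * conj (y j) * ((C j i : ℂ) * M (2 * i + p)) := by
      intro i _
      rw [hu i, map_sum, Finset.sum_mul]
      refine Finset.sum_congr rfl fun j _ ↦ ?_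
      rw [map_mul, Complex.conj_ofReal]
      push_cast
      ring
    rw [Finset.sum_congr rfl e1, Finset.sum_comm]
    have e2 : ∀ j ∈ range nb, ∑ i ∈ range nb, (b j : ℂ) * conj (y j) * ((C j i : ℂ) * M (2 * i + p)) =
        (b j : ℂ) * conj (y j) * y j := by
      intro j _
      rw [← Finset.mul_sum]
      congr 1
    rw [Finset.sum_congr rfl e2, Finset.mul_sum]
    refine Finset.sum_congr rfl fun j hj ↦ ?_
    have e3 : ∀ j' ∈ range nb, ((if j = j' then 2 * b j else 0 : ℝ) : ℂ) * (conj (y j) * y j') =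
        if j = j' then (2 * b j : ℂ) * (conj (y j) * y j') else 0 := by
      intro j' _
      split_ifs
      · push_cast; ring
      · simp
    rw [Finset.sum_congr rfl e3, Finset.sum_ite_eq, if_pos hj]
    ring
  have hu2 : ∑ i ∈ range nb, ∑ i' ∈ range nb,
      conj (c.base.uVec M (2 * i + p)) * c.base.uVec M (2 * i' + p) * (c.base.hBlkQ p i i' : ℂ) =
      ∑ j ∈ range nb, ∑ j' ∈ range nb,
        (∑ i ∈ range nb, ∑ i' ∈ range nb,
          ((C j i * b j : ℝ) : ℂ) * (c.base.hBlkQ p i i' : ℂ) * ((C j' i' * b j' : ℝ) : ℂ)) *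
          (conj (y j) * y j') := by
    rw [← WeilAlg.quad_transform nb nb (fun i i' ↦ (c.base.hBlkQ p i i' : ℂ)) (fun i j ↦ C j i * b j) y]
    refine Finset.sum_congr rfl fun i _ ↦ Finset.sum_congr rfl fun i' _ ↦ ?_
    rw [hu i, hu i']
    ring
  rw [hu1, hu2, ← Finset.sum_sub_distrib]
  refine Finset.sum_congr rfl fun j hj ↦ ?_
  rw [← Finset.sum_sub_distrib]
  refine Finset.sum_congr rfl fun j' hj' ↦ ?_
  have hH := c.base.getM_hpBlk p (Finset.mem_range.1 hj) (Finset.mem_range.1 hj')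
  have eH : ∑ i ∈ range nb, ∑ i' ∈ range nb,
      ((C j i * b j : ℝ) : ℂ) * (c.base.hBlkQ p i i' : ℂ) * ((C j' i' * b j' : ℝ) : ℂ) =
      (b j : ℂ) * b j' * (((getM (c.base.hpBlk p) j j' : ℚ) : ℝ) : ℂ) := by
    rw [hH, hC, hb]
    push_cast
    rw [← hnb, Finset.mul_sum, Finset.sum_comm]
    refine Finset.sum_congr rfl fun i' _ ↦ ?_
    rw [Finset.sum_mul, Finset.mul_sum]
    refine Finset.sum_congr rfl fun i _ ↦ ?_
    ring
  rw [eH, hb]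
  split_ifs <;> push_cast <;> ring

/-- **The gap block identity.** For `p < 2` and `D C = I`:
`Σ_{ii'} P_r[2i+p][2i'+p] conj(M) M + κ' (Bessel expression) + [p = 0] λ |Σ_j c_j y_j|²-form
 = Σ_{jj'} S_p(j,j') conj(y_j) y_{j'}` (`WeilCert.block_identity` for the base with the table `nu`,
`bessel_identity`, and `sgFun_eq`). [folklore] -/
theorem block_identity_gap {p : ℕ} (hp : p < 2) (hDC : c.base.checkDC p = true) (M : ℕ → ℂ) :
    (∑ i ∈ range c.base.nb, ∑ i' ∈ range c.base.nb,
        (c.base.prQ c.nu (2 * i + p) (2 * i' + p) : ℂ) * (conj (M (2 * i + p)) * M (2 * i' + p))) +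
      (c.kappaG : ℂ) *
        (2 * ∑ i ∈ range c.base.nb, conj (c.base.uVec M (2 * i + p)) * M (2 * i + p) -
          ∑ i ∈ range c.base.nb, ∑ i' ∈ range c.base.nb,
            conj (c.base.uVec M (2 * i + p)) * c.base.uVec M (2 * i' + p) * (c.base.hBlkQ p i i' : ℂ)) +
      (if p = 0 then (c.lam : ℂ) else 0) * ∑ j ∈ range c.base.nb, ∑ j' ∈ range c.base.nb,
          ((getV c.cvec j * getV c.cvec j' : ℚ) : ℂ) * (conj (c.base.yVec M p j) * c.base.yVec M p j') =
      ∑ j ∈ range c.base.nb, ∑ j' ∈ range c.base.nb,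
        (c.sgFun p j j' : ℂ) * (conj (c.base.yVec M p j) * c.base.yVec M p j') := by
  have hbase := WeilCert.block_identity (c := c.base) (nu := c.nu) hp hDC M
  have hbes := bessel_identity (c := c) hp M
  -- entrywise: sgFun = spFun − (θ + nuErr) B + [p = 0] λ c c'
  have hent : ∀ j ∈ range c.base.nb, ∀ j' ∈ range c.base.nb,
      (c.sgFun p j j' : ℂ) * (conj (c.base.yVec M p j) * c.base.yVec M p j') =
        (WeilCert.spFun c.base c.nu p j j' : ℂ) * (conj (c.base.yVec M p j) * c.base.yVec M p j') -
          ((c.theta + c.nuErrQ : ℚ) : ℂ) *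
            (((((if j = j' then 2 * c.base.bQ p j else 0) -
              c.base.bQ p j * c.base.bQ p j' * getM (c.base.hpBlk p) j j' : ℚ) : ℝ) : ℂ) *
              (conj (c.base.yVec M p j) * c.base.yVec M p j')) +
          (if p = 0 then (c.lam : ℂ) else 0) * (((getV c.cvec j * getV c.cvec j' : ℚ) : ℂ) *
              (conj (c.base.yVec M p j) * c.base.yVec M p j')) := by
    intro j hj j' hj'
    rw [c.sgFun_eq p (Finset.mem_range.1 hj) (Finset.mem_range.1 hj')]
    split_ifs <;> push_cast <;> ring
  rw [Finset.sum_congr rfl fun j hj ↦ Finset.sum_congr rfl fun j' hj' ↦ hent j hj j' hj']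
  simp only [Finset.sum_add_distrib, Finset.sum_sub_distrib, ← Finset.mul_sum]
  rw [← hbase, ← hbes]
  have hκ : (c.kappaG : ℂ) = (c.base.kappaQ c.nu : ℂ) - ((c.theta + c.nuErrQ : ℚ) : ℂ) := by
    rw [kappaG]; push_cast; ring
  rw [hκ]
  ring

end WeilGapCert

end Summit.RiemannHypothesis.RiemannHypothesis.Theorems.WeilGroundState
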